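import Summits.QuantumAdvantage.QuantumAdvantage.Theorems.ResponseDialE

/-!
# ResponseDial REV 1 delta (§9–§13) — Theorems twin (tree landing, census lane decomp-qadv g10) of NODE «ResponseDial» REV 1 (e6824713…, 2625 l)

Verbatim content of the lens node file `run/shared/lean/pub/decomp-qadv/decomp-qadv-lens-2/g19/ResponseDial.lean` §9–§13 under the (§1–§8 = tree parts ResponseDialA–E)
`Theorems.ResponseDial` namespace (the node elaborates under `Theses.ResponseDial`); the `#print axioms` guard block is dropped (the gate records axioms).
Supports stmt-QuantumAdvantage-27656 (`Theses.SparsityDial.DenseGenericLoss3`); `antipodalLoss3` closes the §5 rung `Theorems.SparsityDial.AntipodalLoss3` of the landed SparsityDial twin BY NAME.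

# NODE «ResponseDial» (decomp-qadv-lens-2, gen 19; RESIDUAL MODE on `SparsityDial.DenseGenericLoss3` = D, stmt-27656)

Lens: structural dichotomy (special vs generic).  Dial phrase (new in the lineage V1–V20): **additivity of the deviation
field's RESPONSE along adjacent-pair-flip orbits** — flip the five separated pairs `{b_i, b_i+1}` in every sub-pattern
`ε ∈ {0,1}^5`; the strategy's deviation set responds ADDITIVELY at `x` if `dev(x^ε) = dev(x) Δ (Δ_{i ∈ ε} R_i)` for some
response sets `R_i` (`AddResp`).  Pointer-type readers (`d_j = x_{a(j)} ⊕ junk-free`), and more generally every field whose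
deviation indicators are `𝔽₂`-affine in the input, respond additively at every input.

## What is PROVED here (0 sorry)
* §1–§2 **THE ADDITIVE-RESPONSE ORBIT LAW** (`additive_orbit_loses`, `additive_loss_count`): for EVERY strategy (no
  degree hypothesis), every admissible site tuple and every odd `x` at which the response is additive, one of the 32
  orbit points loses; hence `#{odd, additively responding} ≤ 32 · #{odd losers}`.  Mechanism: along the orbit the kernel
  phases move by `c_k(x^ε) = c_k(x) + Σ_{i∈ε, b_i<k} ±1` (`cN_orbF_cast`); the win condition at the 32 points is an
  `𝔽₂`-linear system in the unknown phase-class pattern sets whose all-win instance is INFEASIBLE — witnessed by 32 dual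
  certificates (`certN`, one per sign vector, found by Gaussian elimination, checked by `decide` through `CertOK`).
* §4 **the lineage's BC5 rung `SparsityDial.AntipodalLoss3` is now a THEOREM** (`antipodalLoss3`, loss `≥ 1/32`):
  the antipodal family responds additively everywhere (`apStrat_addResp`).
* §6 **the dial**: `StabAdd e P` (cheaply additivizable: some gauge of degree `≤ (log₂N)^e`, some site tuple, a.e. odd
  input responds additively); piece A `AddLoss3` (cheaply additivizable low-degree strategies lose `≥ n⁻¹`) is a THEOREM
  (`addLoss3`); piece B = the residual `NonAddGenericLoss3` (D restricted to `¬ StabAdd (c+1) P`);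
  `closes : AddLoss3 → NonAddGenericLoss3 → DenseGenericLoss3` and the exact converse; hence
  `nonAdd_iff_dense : NonAddGenericLoss3 ↔ DenseGenericLoss3` OUTRIGHT.
* §7 a CERTIFIED-DENSE member on which the law is silent: the HALF-COUNTER family `hcStrat` (antipodal pointer on
  `[1, N/2)`, canonical guess toggled by the common counter `[#{odd i : x_i} ≡ 0 (3)]` elsewhere; degree 4):
  `hcStrat_not_polylogSparse` (E1 transfers to every family agreeing with `apStrat` on the first half:
  `not_polylogSparse_of_agree`), `halfCounterLoss3_of_dense : D → HalfCounterLoss3` (the residual's first rung, OPEN);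
  §8 `hcStrat_not_addResp`: it responds NON-additively at EVERY input along EVERY admissible orbit (zero gauge);
  `apStrat_stabAdd`: the antipodal family IS cheaply additivizable — the dial cuts inside the dense class.

## Honest classification (NODE OUTPUT CONTRACT)
This is a **LAW node, not a certified split**: piece A is DECIDED, so the residual B is EQUIVALENT to the target
modulo the theorem (`nonAdd_iff_dense`) — B is not strictly weaker than D in implicational strength; it is SMALLER in
extension (the target class shrinks to the non-additivizable dense fields, and the whole `𝔽₂`-affine-response world,
incl. every pointer family the lineage has used as a witness, is removed by a theorem).  Per the critic's LAW/LADDER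
doctrine no child route is requested; the memo `NODE-g19.md` records the re-typed residual, the closed rung, the new
open rung `HalfCounterLoss3`, and the two open ENGINE questions (E3: is `hcStrat` additivizable by a non-zero cheap gauge —
the continuant automaton; CM: does the orbit-certificate method extend to common-mode mod-3 counter toggles at `F ≥ 8`). -/

set_option linter.dupNamespace false
noncomputable section
open scoped Classical

namespace Summit.QuantumAdvantage.QuantumAdvantage.Theorems.ResponseDial
open Finset
open Literature.Computability.QuantumComplexity Literature.Computability.QuantumComplexity.RingHLF
open Literature.Computability.MetaComplexity Literature.Computability.MetaComplexity.Smolensky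
open Summit.QuantumAdvantage.AdviceFreeQNC0
open Summit.QuantumAdvantage.QuantumAdvantage.Theorems.AnchorDial (outB dev cN orbF orbL orbL_cons fz
  cN_orbF_cast oddZeros_orbF win_iff gCond_iff_cN card_filter_orbF orbF_false flip2 card_odd_ge loss_shape_mono)
open Summit.QuantumAdvantage.QuantumAdvantage.Theorems.AnchorDial.Core (ct sg)
open Summit.QuantumAdvantage.QuantumAdvantage.Theorems.HolonomyDial (gCond tPoly tPoly_apply tPoly_mem card_odd_le
  xorP xorP_mem xorP_apply_bool mono_singleton_apply indP indP_mem indP_apply)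
open Summit.QuantumAdvantage.QuantumAdvantage.Theorems.StabilizerDial (apIdx apStrat apStrat_mem bitP bitP_apStrat
  pad rel_pad_iff outB_pad_zero pad_mem StabFew rowMask bitP_pad mem_dev_pad_apStrat_iff BlockRec
  blockSelect_of_fewLocus goodBound_of_blockRec fibreIdentityAt_of_block oddSliceBound_holds eventually_polylog
  side_bounds)
open Summit.QuantumAdvantage.QuantumAdvantage.Theorems.LocusDial (Coverable FewLocus)
open Summit.QuantumAdvantage.QuantumAdvantage.Theorems.SparsityDial (real_loss_of_frac AntipodalLoss3 stabFew_mono_mr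
  one_le_logpow)
open Summit.QuantumAdvantage.QuantumAdvantage.Theses.SparsityDial (DenseGenericLoss3)

/-! ## §9  COROLLARY: every strategy with an 𝔽₂-AFFINE deviation field is decided.
If each deviation indicator `[k ∈ dev P y]` is an affine function `t_k + Σ_{j ∈ A_k} y_j (mod 2)` of the input
(EVERY pointer family whose pointed cell's indicator is a literal, every XOR pattern, every 𝔽₂-linear-hash table with
XOR read-out), the response to the pair-flip orbit is additive with response sets `R_i = {k : |A_k ∩ {b_i, b_i+1}| odd}`,
so the law applies at EVERY odd input: `#odd ≤ 32 · #{odd losers}` (`affine_loss_count`), and such a `P` is in piece A's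
class at the zero gauge (`affine_stabAdd`). -/

section Affine
variable {N : ℕ}

/-- parity bookkeeping: flipping `f` on the cells satisfying `p` changes the number of set cells inside `A` by
`#(A ∩ p)` modulo 2. -/
theorem card_flip_mod_two {α : Type*} [DecidableEq α] (A : Finset α) (f : α → Bool) (p : α → Prop)
    [DecidablePred p] :
    ((A.filter fun j => (if p j then !f j else f j) = true).card + (A.filter fun j => f j = true).card) % 2 =
      (A.filter p).card % 2 := by
  induction A using Finset.induction_on with
  | empty => simp
  | @insert a s ha ih =>
    rw [filter_insert, filter_insert, filter_insert]
    by_cases hp : p a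
    · cases hfa : f a
      · simp only [hp, ite_true, Bool.not_false, Bool.false_eq_true, ite_false]
        rw [card_insert_of_notMem (fun h => ha (mem_filter.1 h).1),
          card_insert_of_notMem (fun h => ha (mem_filter.1 h).1)]
        omega
      · simp only [hp, ite_true, Bool.not_true, Bool.false_eq_true, ite_false]
        rw [card_insert_of_notMem (fun h => ha (mem_filter.1 h).1),
          card_insert_of_notMem (fun h => ha (mem_filter.1 h).1)]
        omega
    · cases hfa : f a
      · simp only [hp, Bool.false_eq_true, ite_false]
        exact ih
      · simp only [hp, ite_true, ite_false]
        rw [card_insert_of_notMem (fun h => ha (mem_filter.1 h).1),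
          card_insert_of_notMem (fun h => ha (mem_filter.1 h).1)]
        omega

/-- a sum is odd iff an odd number of its terms are odd. -/
theorem sum_mod_two_eq {ι : Type*} [DecidableEq ι] (T : Finset ι) (c : ι → ℕ) :
    (∑ i ∈ T, c i) % 2 = (T.filter fun i => c i % 2 = 1).card % 2 := by
  induction T using Finset.induction_on with
  | empty => simp
  | @insert a s ha ih =>
    rw [sum_insert ha, filter_insert]
    by_cases hc : c a % 2 = 1
    · rw [if_pos hc, card_insert_of_notMem (fun h => ha (mem_filter.1 h).1)]
      omega
    · rw [if_neg hc]
      omega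

/-- the response sets of an affine deviation field: `k` responds to site `i` iff `A_k` meets the pair `{b_i, b_i+1}`
in an odd number of cells. -/
def affResp (b : Fin 5 → ℕ) (A : Fin N → Finset (Fin N)) (i : Fin 5) : Finset (Fin N) :=
  univ.filter fun k => ((A k).filter fun j : Fin N => j.val = b i ∨ j.val = b i + 1).card % 2 = 1

/-- the number of flipped cells inside `A`, as a sum over the flagged sites. -/
theorem card_filter_flipped {b : Fin 5 → ℕ} (hb : ∀ i j : Fin 5, i < j → b i + 2 ≤ b j) (ε : Fin 5 → Bool)
    (A : Finset (Fin N)) :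
    (A.filter fun j : Fin N => ∃ i, ε i = true ∧ (j.val = b i ∨ j.val = b i + 1)).card =
      ∑ i ∈ (univ : Finset (Fin 5)).filter (fun i => ε i = true),
        (A.filter fun j : Fin N => j.val = b i ∨ j.val = b i + 1).card := by
  rw [← card_biUnion]
  · congr 1
    ext j
    simp only [mem_filter, mem_biUnion, mem_univ, true_and]
    constructor
    · rintro ⟨hj, i, hi, h⟩
      exact ⟨i, hi, hj, h⟩
    · rintro ⟨i, hi, hj, h⟩
      exact ⟨hj, i, hi, h⟩
  · intro i _ i' _ hii'
    rw [Function.onFun, Finset.disjoint_left]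
    intro j hj hj'
    rw [mem_filter] at hj hj'
    rcases lt_or_gt_of_ne hii' with h | h
    · have := hb i i' h
      omega
    · have := hb i' i h
      omega

/-- **an 𝔽₂-affine deviation field responds additively** (along the orbit of `x`; the affine representation is only
needed ON that orbit). -/
theorem affine_addResp {b : Fin 5 → ℕ} (hb : ∀ i j : Fin 5, i < j → b i + 2 ≤ b j)
    (P : Fin N → CubeFn (ZMod 3) N) (A : Fin N → Finset (Fin N)) (t : Fin N → ℕ) (x : Fin N → Bool)
    (haff : ∀ (ε : Fin 5 → Bool) (k : Fin N),
      k ∈ dev P (orbF b ε x) ↔ (((A k).filter fun j => orbF b ε x j = true).card + t k) % 2 = 1) :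
    AddResp b P (affResp b A) x := by
  intro ε k
  have h1 := haff ε k
  have h0 := haff (fun _ => false) k
  rw [orbF_false] at h0
  have hflip : ((A k).filter fun j => orbF b ε x j = true) =
      (A k).filter fun j => (if (∃ i, ε i = true ∧ (j.val = b i ∨ j.val = b i + 1)) then !x j else x j) = true := by
    refine filter_congr fun j _ => ?_
    rw [orbF_apply hb ε x j]
  have hL1 := card_flip_mod_two (A k) x (fun j : Fin N => ∃ i, ε i = true ∧ (j.val = b i ∨ j.val = b i + 1))
  rw [← hflip] at hL1
  have hL2 : ((A k).filter fun j : Fin N => ∃ i, ε i = true ∧ (j.val = b i ∨ j.val = b i + 1)).card % 2 =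
      (univ.filter fun i : Fin 5 => ε i = true ∧ k ∈ affResp b A i).card % 2 := by
    rw [card_filter_flipped hb ε (A k), sum_mod_two_eq, filter_filter]
    congr 2
    refine filter_congr fun i _ => ?_
    simp only [affResp, mem_filter, mem_univ, true_and]
  rw [h1, h0]
  omega

/-- **COROLLARY (counting form)**: a strategy whose deviation field is 𝔽₂-affine in the input wins on at most a
`(1 − 1/32)` fraction of the odd class (`3 ≤ N`, any 5 separated sites inside `[0, N-3]`). -/
theorem affine_loss_count (hN : 3 ≤ N) {b : Fin 5 → ℕ} (hb : ∀ i j : Fin 5, i < j → b i + 2 ≤ b j)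
    (hbN : ∀ i, b i + 3 ≤ N) (P : Fin N → CubeFn (ZMod 3) N) (A : Fin N → Finset (Fin N)) (t : Fin N → ℕ)
    (haff : ∀ (y : Fin N → Bool) (k : Fin N),
      k ∈ dev P y ↔ (((A k).filter fun j => y j = true).card + t k) % 2 = 1) :
    (univ.filter fun x : Fin N → Bool => OddZeros x).card ≤
      32 * (univ.filter fun x : Fin N → Bool => OddZeros x ∧ ¬ Rel x (outB P x)).card := by
  have h := additive_loss_count hN hb hbN P
  have heq : (univ.filter fun x : Fin N → Bool => OddZeros x ∧ ∃ R : Fin 5 → Finset (Fin N), AddResp b P R x) =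
      univ.filter fun x : Fin N → Bool => OddZeros x := by
    refine filter_congr fun x _ => ?_
    simp only [and_iff_left_iff_imp]
    intro _
    exact ⟨affResp b A, affine_addResp hb P A t x fun ε k => haff _ k⟩
  rw [heq] at h
  exact h

/-- evenly spread sites `0, 2, 4, 6, 8` (valid as soon as `11 ≤ N`). -/
def evenSite (i : Fin 5) : ℕ := 2 * i.val

/-- ResponseDialF helper `evenSite_sites` (decomp-qadv land package; see the module docstring). -/
theorem evenSite_sites (hN : 11 ≤ N) : Sites N evenSite := by
  refine ⟨fun i j hij => ?_, fun i => ?_⟩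
  · have : i.val < j.val := hij
    unfold evenSite; omega
  · have := i.isLt
    unfold evenSite; omega

/-- an affine deviation field is in piece A's class (zero gauge, sites `0,2,4,6,8`, EVERY input). -/
theorem affine_stabAdd (hN : 11 ≤ N) (e : ℕ) (P : Fin N → CubeFn (ZMod 3) N) (A : Fin N → Finset (Fin N))
    (t : Fin N → ℕ)
    (haff : ∀ (y : Fin N → Bool) (k : Fin N),
      k ∈ dev P y ↔ (((A k).filter fun j => y j = true).card + t k) % 2 = 1) :
    StabAdd e P := by
  refine ⟨fun _ => 0, fun _ => Submodule.zero_mem _, evenSite, evenSite_sites hN, ?_⟩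
  have h0 : (univ.filter fun x : Fin N → Bool => OddZeros x ∧
      ¬ ∃ R : Fin 5 → Finset (Fin N), AddResp evenSite (pad P (fun _ => 0)) R x) = ∅ := by
    rw [Finset.filter_eq_empty_iff]
    intro x _ h
    exact h.2 ⟨affResp evenSite A, (addResp_pad_zero_iff _ _ _ x).2
      (affine_addResp (evenSite_sites hN).1 P A t x fun ε k => haff _ k)⟩
  rw [h0, card_empty, Nat.mul_zero]
  exact Nat.zero_le _

/-- the antipodal family is the instance `A_k = {apIdx k}`, `t_k = 0` (sanity link to §4). -/
theorem apStrat_affine (y : Fin N → Bool) (k : Fin N) :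
    k ∈ dev (fun i : Fin N => apStrat i) y ↔
      ((({apIdx k} : Finset (Fin N)).filter fun j => y j = true).card + 0) % 2 = 1 := by
  rw [mem_dev_apStrat, filter_singleton]
  cases y (apIdx k) <;> simp

end Affine




end Summit.QuantumAdvantage.QuantumAdvantage.Theorems.ResponseDial
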